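import Mathlib
import HarnessLib
import HarnessLib.Audit
import Summits.NavierStokesRegularity.Statement
import Literature.Analysis.FluidPDE.ClassicalSolution
import Literature.Analysis.FluidPDE.LerayHopf
import Literature.Analysis.FluidPDE.SuitableWeak
import Literature.Analysis.FluidPDE.SelfSimilar
import Literature.Analysis.FluidPDE.WeakSolution
import Literature.Analysis.FluidPDE.VectorCalculus
import Literature.Analysis.FluidPDE.MildSolution
import Literature.Analysis.FluidPDE.NSWave0
import Literature.Analysis.UnboundedOperators.HeatKernel
import Summits.NavierStokesRegularity.NavierStokesRegularity.Theorems.TypeICertificateLadderNoBlowupToClay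
import HarnessLib.Audit.Status.Attr

/-!
Route: ClockStretchingLaw

# Route ClockStretchingLaw — a Type-I singularity must out-stretch its own clock — clock-amplitude
dichotomy for Type-I models

It suffices to show X_sing = NoSingularTypeIModel: no smooth divergence-free KNSS-mild ancient
solution u on ℝ³×(−∞,0)
(Oseen integral equation — the KNSS gauge, shared with route SymmetryModuliCount; since rev 2 the
Oseen–Koch–Tataru kernel
e^{τΔ}P∇· is written out through `UnboundedOperators.heatKernel`, definitionally equal to
`FluidPDE.oseenKernel`, so that the
route's import cone is free of KochTataru/CriticalRegularity) with the Type-I sup-rate |u| ≤ C/√(−t)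
AND scale-invariant
local energies (A, E ≤ C on every parabolic cylinder below t = 0, Albritton–Barker's Type-I class)
is SINGULAR at the space-time
origin (unbounded in every Q(0,r)). Card clock-mode-stretching-law splits X_sing by its CLOCK
AMPLITUDE
a_u(t) := (−t)^{3/2} ∫|∂_t u(x,t)|² e^{−|x|²/(4(−t))} dx = ‖W(s)‖²_{L²_ρ}, the Gaussian-weighted
size of the time-translation
Jacobi field W = ∂_sU + ½U + ½y·∇U = ΔU − U·∇U − ∇P (= the steady-Navier–Stokes residual of the
Leray profile U, s = −log(−t)):
X_sing ⇐ ClockCeiling (inf_{[−1,0)} a_u = 0 for every Type-I model) ∧ ClockLaw (a singular Type-I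
model keeps a_u ≥ δ > 0).
SingularZoom (Albritton–Barker forward direction) turns X_sing into "no Type-I blow-up"; NoTypeII
(shared stmt-0056) and
NoBlowupToClay (shared stmt-0055) finish Clay (A).
Lean: `∀ (C : ℝ) (u : ℝ → EuclideanSpace ℝ (Fin 3) → EuclideanSpace ℝ (Fin 3)), ContDiffOn ℝ (⊤ :
ℕ∞) (Function.uncurry u) (Set.Iio 0 ×ˢ Set.univ) ∧ (∀ t < 0,
Literature.Analysis.FluidPDE.VectorCalculus.IsDivFree (u t)) ∧ (∀ s t : ℝ, s < t → t < 0 → ∀ x, u t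
x = Literature.Analysis.FluidPDE.heatFlow (u s) (t - s) x - ∫ τ in Set.Ioo s t, ∫ y, ((-(inner ℝ (x
- y) (u τ y) / (2 * (t - τ)) * Literature.Analysis.UnboundedOperators.heatKernel (t - τ) (x - y))) •
u τ y + (∫ σ in Set.Ioi (t - τ), Literature.Analysis.UnboundedOperators.heatKernel σ (x - y) / (4 *
σ ^ 2)) • (inner ℝ (x - y) (u τ y) • u τ y + inner ℝ (u τ y) (u τ y) • (x - y) + inner ℝ (x - y) (u
τ y) • u τ y) - ((∫ σ in Set.Ioi (t - τ), Literature.Analysis.UnboundedOperators.heatKernel σ (x -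
y) / (8 * σ ^ 3)) * (inner ℝ (x - y) (u τ y) * inner ℝ (x - y) (u τ y))) • (x - y))) ∧
Literature.Analysis.FluidPDE.HasTypeITimeDecay C u ∧ (∀ (x₀ : EuclideanSpace ℝ (Fin 3)) (t₀ r : ℝ),
t₀ ≤ 0 → 0 < r → (∀ t, t₀ - r ^ 2 < t → t < t₀ → r⁻¹ * ∫ x in Metric.ball x₀ r, ‖u t x‖ ^ 2 ≤ C) ∧
r⁻¹ * ∫ t in Set.Ioo (t₀ - r ^ 2) t₀, ∫ x in Metric.ball x₀ r, ‖fderiv ℝ (u t) x‖ ^ 2 ≤ C) → ¬ (∀ r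
> 0, ∀ M : ℝ, ∃ t ∈ Set.Ioo (-(r ^ 2)) (0 : ℝ), ∃ x ∈ Metric.ball (0 : EuclideanSpace ℝ (Fin 3)) r,
M < ‖u t x‖)`

## Assembly
Pure logic (Sketch.lean / glue.lean `closes`, lean check rc 0, 0 sorries): apply NoBlowupToClay;
given a finite-energy classical
solution on [0,T) from a rapidly decaying datum with no smooth extension past T, it is maximal,
NoTypeII gives the Type-I rate;
ClockLaw and ClockCeiling contradict each other on any singular element of the Type-I class, so
X_sing holds; SingularZoom with
X_sing and the Type-I rate yields the extension — contradiction. SteadySliceLiouville and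
SmallStrainRung are engine/support
items and do not enter `closes`.

Rationale: WHY THIS LINE. Mechanism (card clock-mode-stretching-law, audited new-combination): every space-time
symmetry of NS is an EXACT solution of the
linearised Leray-gauge equation ∂_sV = L_U V with a pinned rate equal to half its parabolic weight —
time translation ∂_t u ↦ e^{s}W
(rate 1), space translations ↦ e^{s/2}∂_jU (rate ½), rotations/scaling (rate 0) — while the
Ornstein–Uhlenbeck part
𝓛 = Δ − ½y·∇ − ½ is self-adjoint on L²_ρ with top eigenvalue −½; the energy identity d/ds ½a =
−‖∇W‖²_ρ − (3/2)a + N_U(W)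
therefore says that a Type-I model whose clock amplitude stays bounded below must extract from its
own profile a time-averaged
normalised stretching ⟨N_U(Ŵ) − ‖∇Ŵ‖²_ρ⟩ of EXACTLY 3/2 = 1 + ½ ("a singularity must out-stretch its
own clock"; with the three
translation modes the bill is 5 = the parabolic dimension). Imported areas: parabolic blow-up theory
of the semilinear heat
equation (GigaKohn1985, MerleZaag1998: symmetry eigenvalues 1, ½ in similarity variables;
GallayWayne2005 §4.1 for forward NS),
Lyapunov-rate / Constantin–Foias–Temam volume bookkeeping (Temam1997, DoeringGibbon1995), and the
Type-I blow-up dictionary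
(KNSS2009, AlbrittonBarker2019, RusinSverak2011 persistence of singularities; DongZhang2020 time
analyticity for the steady-slice
lemma). What it does that route SymmetryModuliCount does not: it uses the time-translation ("clock")
mode that the Sim(3) moduli
count gauges away, works with exact RATES instead of dimensions, needs no helical /
rotated-self-similar sub-Liouville, and its
non-degeneracy (ClockLaw) is a theorem-candidate resting on persistence of singularities + a
one-instant steady Liouville lemma;
the two routes share only the downstream items 0056/0055. Negatives index empty at filing.

RANKED CRUXES. #0 NoSingularTypeIModel (target) — X_sing: for every C, no smooth div-free KNSS-mild
ancient solution on ℝ³×(−∞,0) with |u| ≤ C/√(−t) and scale-invariant local energies sup_{Q(z,r),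
t₀≤0} [r⁻¹ sup_t ∫_{B_r}|u|² , r⁻¹∫∫_{Q}|∇u|²] ≤ C is singular (unbounded in every parabolic
cylinder Q(0,r)) at the space-time origin. Weaker than TypeIAncientLiouville
(stmt-NavierStokesRegularity-4050) and than (L) (stmt-0057), still kills Type-I blow-up via
SingularZoom. Follows from ClockCeiling ∧ ClockLaw by two lines of logic (Sketch.lean
`target_of_cruxes`). (why it might fail: ¬X_sing = a singular Type-I model, e.g. the blow-up profile
of a backward discretely self-similar solution (BradshawTsai2017CPDE Open Problem 5.1, Tsai2018 Conj
8.8); open even for one discrete symmetry (ChaeWolf2017RemovingDSS removes only λ≈1 / small C).)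
[KNSS2009, AlbrittonBarker2019, BradshawTsai2017CPDE, Tsai2018, ChaeWolf2017RemovingDSS]
#2 ClockCeiling (crux) — (card K1/K2, the bet) Along every element u of the Type-I class of the
target, the clock amplitude a_u(t) = (−t)^{3/2}∫|∂_t u(x,t)|² e^{−|x|²/(4(−t))}dx (= ‖W(s)‖²_{L²_ρ},
W = (−t)^{3/2}∂_t u in similarity variables = ΔU − U·∇U − ∇P, the steady-NS residual of the Leray
profile) is NOT bounded below on [−1,0): for every δ > 0 some t ∈ [−1,0) has a_u(t) < δ. At an
origin where u is bounded this is automatic (a_u(t) = O((−t)³) + Gaussian tail, the far-field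
pressure gradient being bounded by the scaled energy A); the content is at singular origins.
Intended engine: the exact Leray-gauge identity d/ds ½a = −‖∇W‖²_ρ − (3/2)a + N_U(W) (N_U = strain
compression + Gaussian inflow + pressure work of the clock mode; OU min-max ⟨−𝓛φ,φ⟩_ρ ≥ ½‖φ‖²), so
inf a > 0 forces ⟨N_U(Ŵ) − ‖∇Ŵ‖²_ρ⟩_s = 3/2 exactly; the crux bets no Type-I model sustains a
normalised clock stretching of 3/2 (perturbative rung: SmallStrainRung). [difficulty: open-problem]
(why it might fail: Given ClockLaw it is equivalent to absence of singular Type-I models: a backward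
DSS blow-up profile (BradshawTsai2017CPDE Open Problem 5.1) has s-periodic clock amplitude bounded
below; N_U(Ŵ) ≲ ‖S_U‖∞ + moments bounds the clock rate only when (−t)‖∇u‖∞ ≲ 1, nothing does for
large C.) [GigaKohn1985, MerleZaag1998, GallayWayne2005, BradshawTsai2017CPDE, KNSS2009,
CortissozMonteroPinilla2014]
#3 ClockLaw (crux) — (card K1 non-degeneracy, "the clock cannot stop") If an element u of the Type-I
class of the target is singular at the space-time origin, its clock amplitude is bounded below on
[−1,0): ∃ δ > 0, a_u(t) ≥ δ for −1 ≤ t < 0. Proof plan: (i) on [−1,−ε] continuity +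
SteadySliceLiouville (a_u(t*) = 0 means ∂_t u(t*) ≡ 0, hence u ≡ 0, not singular); (ii) along t_n ↑
0 rescale u_n(x,t) = λ_n u(λ_n x, λ_n² t), λ_n = √(−t_n): the class is scale-invariant, KNSS
smoothing gives C^∞_loc(t<0) compactness and L²_ρ-convergence of the clock mode (|∂_t u| ≤
C₂(−t)^{−3/2} + Gaussian tails), the limit ū lies in the class, is singular at the origin by
persistence of singularities (RusinSverak2011 Lemma 2.1-2.2 = AlbrittonBarker2019 Prop 2.3; scaled
energies A, E uniformly bounded, C by interpolation, pressure in the mild gauge) hence nontrivial,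
and a_{u}(t_n) → a_{ū}(−1) > 0 by SteadySliceLiouville again. [deps: SteadySliceLiouville]
[difficulty: L] (why it might fail: Persistence of singularities for profile limits is in print only
with the pressure quantity D controlled (AlbrittonBarker2019 Rem 3.2: sup-rate class delicate); D
must be recovered from A, E + the Oseen gauge, else a singular model asymptotically steady in L²_ρ
along t_n↑0 slips through.) [AlbrittonBarker2019, RusinSverak2011, KNSS2009, DongZhang2020,
arXiv:1811.00502]
#4 NoTypeII (crux) — (shared stmt-NavierStokesRegularity-0056, borrowed not attacked) if a
finite-energy classical solution from a rapidly decaying datum has maximal lifespan T < ∞ then it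
blows up at the Type-I rate ‖u(t)‖_∞ ≤ C(T−t)^{−1/2}. [difficulty: open-problem] (why it might fail:
No theorem bounds a blow-up rate from above. Tao's averaged-NS blow-up is Type II (arXiv:1402.0290
p.8 fn.), so abstract methods cannot prove it; KNSS2009 p.4: every axisymmetric singularity is Type
II, so Hou's axisymmetric candidate (arXiv:2107.06509), if real, refutes it (= ¬Clay A).)
[Tao2016AveragedNS, arXiv:1402.0290, KNSS2009, Hou2022PotentiallySingularNS, arXiv:2107.06509,
Seregin2012]
#9 SteadySliceLiouville (support) — (card degeneracy lemma, clock case; known ingredients) a smooth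
div-free KNSS-mild ancient solution with |u| ≤ C/√(−t) and ONE steady slice ∂_t u(t₀,·) ≡ 0 (t₀ < 0)
is identically zero: ∂_t^n u(t₀,·) ≡ 0 inductively (∂_t p = R_iR_j∂_t(u_iu_j) in the mild gauge),
time analyticity of bounded mild solutions (DongZhang2020 Thm 2 = arXiv:1907.01687, radius depending
only on the L^∞ bound) propagates u(t) = u(t₀) to all t < 0, and |u(t₀,x)| = |u(t,x)| ≤ C/√(−t) → 0
as t → −∞. (Forward uniqueness alone is useless: the Type-I bound is void as t ↑ 0.) May take a
named DongZhang2020 fact as hypothesis if the grounder so rules. [difficulty: L] [DongZhang2020,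
arXiv:1907.01687, KNSS2009, Seregin2014Notes]
#9 SingularZoom (support) — (glue, KNOWN: AlbrittonBarker2019 §3 forward direction + KNSS2009 §6)
X_sing ⇒ a finite-energy classical solution on [0,T) from a rapidly decaying datum with Type-I rate
near T extends smoothly past T. If not, u is unbounded near T (continuation), the singular set at
time T is a nonempty compact set (far-field ε-regularity, CKN1982), pick a singular point (x₀,T);
the zooms u_k(x,t) = λ_k u(x₀+λ_k x, T+λ_k² t), λ_k ↓ 0 (NO sup-normalisation) keep the sup-rate
constant, inherit scale-invariant energies from 𝐈(Q((x₀,T),ρ)) < ∞ (AlbrittonBarker2019 Lemma 2.5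
'weak Serrin ⇒ Type I', u ∈ L^{2,∞}_t L^∞_x), converge in C^∞_loc(t<0) by KNSS2009 Prop 4.1 bounds
to a KNSS-mild limit ū (dominated convergence in the Oseen identity, kernel bound (14)) which is in
the Type-I class with constant max(C, C′) and singular at (0,0) by persistence of singularities
(RusinSverak2011; AlbrittonBarker2019 Prop 2.3) — contradicting X_sing. May take named facts
(knss2009_smoothing, hasSmoothExtensionPast_of_bounded, CKN ε-regularity) as hypotheses if the
grounder so rules. [difficulty: L] [AlbrittonBarker2019, RusinSverak2011, KNSS2009,
SereginSverak2009, CKN1982]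
#9 NoBlowupToClay (support) — (shared stmt-NavierStokesRegularity-0055) given no blow-up, build the
Clay (A) solution: local finite-energy classical solution for smooth div-free rapidly decaying data,
continuation, weak–strong uniqueness, bounded energy, conversion by
isNavierStokesSolution_and_smooth_iff. [difficulty: provable-now] [Leray1934, FujitaKato1964,
Fefferman2000]
#9 SmallStrainRung (support) — (card K2, perturbative rung of ClockCeiling; TRUE by the vorticity
maximum principle, filed to calibrate the ceiling) a smooth div-free KNSS-mild ancient solution with
|u| ≤ C/√(−t) and (−t)‖∇u(t)‖_{op,∞} ≤ ½ for all t < 0 vanishes: |Sω| ≤ ‖∇u‖_op|ω| gives ‖ω(t)‖_∞ ≤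
‖ω(s)‖_∞((−s)/(−t))^{1/2} ≤ c(−s)^{−1/2}(−t)^{−1/2} → 0 as s → −∞ (any constant < 1 works), so ω ≡
0, u(t,·) is harmonic and bounded hence spatially constant, the Oseen identity (zero-mean kernel)
makes it constant in time, and Type-I decay makes it 0. The card predicts the threshold can be
pushed to the min-max constant of the clock law (layer 2). [difficulty: M] [KNSS2009,
CortissozMonteroPinilla2014, Leray1934]

TWO-LAYER PLAN. Foreseen glued splits (none filed now). (i) ClockCeiling ⇐ FourFrameCeiling →
FourFrameLaw → ClockCeiling: the card's FOUR-FRAME LAW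
(Gram determinant of {(−t)^{3/2}∂_t u, (−t)∂_j u} in L²(ρ_t) bounded below on singular models; needs
the travelling-wave / 2.5-D
one-instant Liouville with fact KNSS2009_liouville_planar) against the weaker bet "inf Gram₄ = 0"
(4-volume cannot grow at 5/2;
constant 5 = parabolic dimension; CFT trace technology improves with dimension). (ii) ClockLaw ⇐
ProfilePersistence (limits of
rescalings of a singular element of the class are singular) → SteadySliceLiouville → ClockLaw. (iii)
ClockCeiling's engine
children once the Leray-gauge stretching form N_U is typed: LerayGaugeEnergyIdentity (d/ds ½a =
−‖∇W‖²_ρ − (3/2)a + N_U(W)) and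
StretchingDeficit (⟨N_U(Ŵ) − ‖∇Ŵ‖²_ρ⟩ < 3/2 along every Type-I model), plus the explicit-constant
upgrade of SmallStrainRung.

KILL CRITERIA. A singular Type-I model (nontrivial backward DSS/Type-I ancient mild solution
singular at the origin) refutes NoSingularTypeIModel
and ClockCeiling at once — close `refuted:ClockCeiling` (no pivot: the line IS the clock dichotomy)
and hand the witness to the
blow-up routes. ClockLaw refuted (a singular element whose clock amplitude → 0 along t_n ↑ 0, i.e.
persistence fails in the
sup-rate + scaled-energy class) ⇒ pivot by restating the class with Albritton–Barker's full 𝐈 < ∞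
(pressure quantity D) or with
space-time decay HasTypeIDecay, via a repaired item. SteadySliceLiouville refuted ⇒ misstatement of
the mild class (repair the
Oseen clause), not of the line. NoTypeII refuted (a Type-II singularity) kills every positive route.
TypeIAncientLiouville
(stmt-4050), NoTypeIBlowup (route TypeICertificateLadder) or (L) (stmt-0057) proved elsewhere moot
the clock cruxes (the target
follows trivially) — the route then closes superseded.

NOT DECOMPOSED YET. The Leray-gauge vocabulary as Lean objects (profile U, clock mode W, stretching
form N_U with the linearised pressure, the
transformation rule P1 'linearised solution ↦ cocycle solution', OU spectral facts P3, the (3/2,5/2)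
polynomial-weight window K3,
Betchov companion law P2) — deliberately not requested at open: the deciding items are stated in
physical variables over accepted
declarations only, so the route is not blocked on definitions; the engine statements are layer-2
children of ClockCeiling. Also
not decomposed: the compactness/persistence package inside ClockLaw, far-field pressure bounds
inside the regular-origin half of
ClockCeiling, everything inside NoTypeII (other routes), the explicit min-max constant of K2.

CHEAPEST FALSIFIER. (a) Symbolic audit requested by the card (an afternoon, sympy/kit): the
transformation rule must give L_U W = W and L_U ∂_jU = ½∂_jU
identically for Leray's profile equation, and on the semilinear heat equation u_t = Δu + |u|^{p−1}u
the clock mode of the constant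
profile κ must be the exact eigenfunction with eigenvalue 1 (GigaKohn1985) — any mismatch kills the
bookkeeping behind ClockCeiling's
engine (not the typed items, which are stated without N_U). (b) Lookup: AlbrittonBarker2019 Rem 3.2
/ Seregin's Type-I papers — is
persistence of singularities available for the sup-rate + (A,E) class without D? If provably not,
ClockLaw must be restated (Kill
criteria). (c) SmallStrainRung is a one-page max-principle proof; a refuter can certify or break the
constant ½ immediately.
Not run here: lit/galaxy services were saturated during this session (see Novelty); the Lean side
(all items + closes) was checked, rc 0.

NUMBERS. Pinned rates in Leray gauge: clock (time translation) 1, space translations ½ (×3),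
rotations/scaling 0 (×4); OU–Stokes top
eigenvalues on vector L²_ρ: −½ (×3, constants), −1 (×8 div-free linear fields); clock-law constant
3/2 = 1 + ½; four-frame constant
5 = (1 + 3·½) + (3·½ + 1) = parabolic dimension; SmallStrainRung threshold ½ (any c₀ < 1 by the
vorticity maximum principle;
explicit-rate literature constants are all ≪ 1: Leray1934 §19, CortissozMonteroPinilla2014); Type-I
notions: sup-rate
(HasTypeITimeDecay, IsTypeIBlowup) + scaled energies A, E (AlbrittonBarker2019 (1.5)-(1.10)). Items
at open: 9 (3 cruxes incl. 1
shared, 4 supports incl. 1 shared, target, assembly) — all typed, Sketch.lean rc 0.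

DEFINITION REQUESTS. None (all items inline accepted declarations: heatFlow,
UnboundedOperators.heatKernel, HasTypeITimeDecay, timeDeriv, VectorCalculus.IsDivFree,
IsClassicalNSSolutionOn, IsLerayHopfOn, HasRapidSpatialDecay, IsTypeIBlowup, HasSmoothExtensionPast,
IsMaximalSmoothSolution).
Rev 2 (cone repair): the Oseen–Koch–Tataru kernel K(τ,z)[a,b] = −(⟨z,a⟩/2τ)G_τ(z)b +
A(τ,z)(⟨z,a⟩b+⟨a,b⟩z+⟨z,b⟩a) − B(τ,z)⟨z,a⟩⟨z,b⟩z,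
A = ∫_τ^∞ G_s(z)/(4s²)ds, B = ∫_τ^∞ G_s(z)/(8s³)ds (KochTataruAdvMath2001 §2 (5)–(8)) is written out
inline in the six class items — definitionally
equal to `FluidPDE.oseenKernel` (certificate: six `Iff.rfl`), whose home module KochTataru.lean
imports CriticalRegularity.lean and with it the
deprecated facts gkp_besov_blowup / albritton_besov_blowup; a promote request asks to re-home
`oseenKernel` in a leaf module, after which the
blob is re-collapsed with no change of meaning. Layer 2 will request `LerayGaugeStretchingForm`
(N_U, with linearised pressure) and `ClockMode` under
Summits/NavierStokesRegularity/NavierStokesRegularity/Theorems when the engine children of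
ClockCeiling are filed.

Novelty: Searches (2026-08-15, this planner; services degraded — recorded as run): `lit search --source
crossref "lower bound time derivative
blow-up rate Navier-Stokes Type I singularity ancient solution steady"` (15 rows:
Chen–Strain–Yau–Tsai axisymmetric rate bounds,
GKP16 Besov blow-up — none on the time-derivative/clock mode); `lit search --source crossref "time
analyticity heat equation
Navier-Stokes bounded mild ancient solutions"` (12: DongZhang2020 doi:10.1016/j.jfa.2020.108563 Thm
2, Zhang2019 PAMS, Masuda1967 —
source of SteadySliceLiouville, read arXiv:1907.01687 §3); `lit search --source zbmath "ancient
solutions Navier-Stokes Type I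
Liouville" --year-from 2015` (2: AlbrittonBarker2019, KTW2022 2-D); `lit search --source zbmath "...
steady state residual lower
bound"` (0); `lit search --source arxiv` ×2 (0 rows, API empty); `lit galaxy search "…" --star
all|pdf` ×3 (galaxyd saturated /
0 substring hits); `lit search --hybrid` local (vector leg only, irrelevant); `lit read
arxiv:1811.00502` (Thm 1.1, Prop 2.3, Lemma
2.5, Rem 3.2 read: fixes the class and the direction s → +∞); openalex budget exhausted (429). Plus
the card's audited searches
(zbMATH ×3, crossref MZ98/00, Zaag01, galaxy pdf 60 rows, OpenAlex/S2/arXiv) and the refuter audit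
AUDIT-17-g2.
Nearest prior art found: MerleZaag1998 (+ Math. Ann. 2000; symmetry rates 1, ½ along general Type-I
ancient solutions of the
semilinear heat equation ⇒ Liouville, WITH a Lyapunov functional), GigaKohn1985, GallayWayne2005 §4.  [refs: 10.1016/j.jfa.2020.108563, 1907.01687, 1811.00502, doi:10.1016/j.jfa.2020.108563, arxiv:1811.00502, DongZhang2020, AlbrittonBarker2019, MerleZaag1998, GigaKohn1985, GallayWayne2005]

Barriers (technique_class: liouville-rigidity, similarity-variables, lyapunov-rates): - technique_class: liouville-rigidity, similarity-variables, lyapunov-rates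
- Literature.Barriers.NavierStokesRegularity.EnergySupercriticality: not engaged coercively —
ClockLaw, SteadySliceLiouville, SingularZoom are scale-invariant statements in Leray gauge using no
supercritical quantity; conceded for ClockCeiling beyond the perturbative rung: it does not evade
it; the bet is that the exact constant 3/2 demanded of the clock mode is a rigidity obstruction, not
an energy bound.
- Literature.Barriers.NavierStokesRegularity.TaoAveragedBlowup: Tao's averaged equation keeps
time/space translations and scaling, so ClockLaw holds for ITS Type-I models too and ClockCeiling
can never follow from estimates shared with averaged bilinear forms — any proof must use
non-averaged structure (exact strain algebra / vorticity maximum principle as in SmallStrainRung,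
Betchov-type identities); Tao's witness is Type II (scope caveat iii), outside X_sing; NoTypeII is
borrowed and openly not evaded.
- Literature.Barriers.NavierStokesRegularity.LeraySelfSimilarBlowupExclusion: consistent and
generalised — for a self-similar profile the clock mode is the exact eigenfunction L_U W = W and
NRS1996/Tsai1998 kill the profile; SteadySliceLiouville replaces 'steady in similarity variables ⇒
trivial' by 'steady at one physical instant ⇒ trivial', ClockLaw by a time-uniform lower bound along
arbitrary (DSS, chaotic) models.
- Literature.Barriers.NavierStokesRegularity.AxisymmetricTypeIExclusion: used onl

History (route lifecycle, newest last):
- 2026-08-15T16:18:41Z · rev 2: restated NoSingularTypeIModel (stmt-NavierStokesRegularity-10215), ClockCeiling (stmt-NavierStokesRegularity-10216), ClockLaw (stmt-NavierStokesRegularity-10217), SteadySliceLiouville (stmt-NavierStokesRegularity-10218), SingularZoom (stmt-NavierStokesRegularity-10219), SmallStrainRung (stmt-NavierStokesRegulari (planner-rrepair-NavierStokesRegularity-ClockSt-753af43a-g2-0)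

sub-problem: NavierStokesRegularity · status: open · opened planner-plancard-NavierStokesRegularity-Navie-3555fad9-0 2026-08-15T15:35:03Z · rev 2 · ledger route-NavierStokesRegularity-ClockStretchingLaw
GENERATED by the gate from the ledger (D-0016/17). Provers cite these decls: `theorem foo : Summit.NavierStokesRegularity.NavierStokesRegularity.Theses.ClockStretchingLaw.<Decl> := …` in Summits/NavierStokesRegularity/NavierStokesRegularity/Theorems/<Name>.lean.
-/

namespace Summit.NavierStokesRegularity.NavierStokesRegularity.Theses.ClockStretchingLaw

open scoped BigOperators Topology Manifold Classical MeasureTheory ProbabilityTheory Matrix InnerProductSpace ComplexConjugate ContinuousMap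
open Filter Set Function TopologicalSpace MeasureTheory

attribute [summit_statement] _root_.NavierStokesRegularity

open Literature.NS

-- earlier NoSingularTypeIModel (stmt-NavierStokesRegularity-10215, replaced 2026-08-15T16:18:41Z -> stmt-NavierStokesRegularity-10569): retired by None — ∀ (C : ℝ) (u : ℝ → EuclideanSpace ℝ (Fin 3) → EuclideanSpace ℝ (Fin 3)), ContDiffOn ℝ (⊤ : ℕ∞) (Function.uncurry u) (Set.Iio 0 ×ˢ Set.univ) ∧ (∀ t < 0, Literature.Analysis.FluidPDE.VectorCalculus.IsDivFree (u t)) ∧ (∀ s t : ℝ, s < t → t < 0 → ∀ x, 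
/-- item stmt-NavierStokesRegularity-10569 · target · rank 0 · open · by planner
why it might fail: ¬X_sing = one singular Type-I model: the t↑0 profile of a backward (rotated) DSS Type-I blow-up would be one (BradshawTsai2017 OP5.1; Tsai2018 Conj 8.8-8.9), excluded only for SS (NecasRuzickaSverak1996, Tsai1998) and λ≈1 or extreme rotation rate (ChaeWolf2017 Thm1.3, PineauVicol2026 Thms1.4/1.7).
sources: KNSS2009, AlbrittonBarker2019, BradshawTsai2017CPDE, Tsai2018, ChaeWolf2017RemovingDSS, PineauVicol2026
[target] X_sing: for every C, no smooth div-free KNSS-mild ancient solution on ℝ³×(−∞,0) with |u| ≤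
C/√(−t) and scale-invariant local energies sup_{Q(z,r), t₀≤0} [r⁻¹ sup_t ∫_{B_r}|u|² ,
r⁻¹∫∫_{Q}|∇u|²] ≤ C is singular (unbounded in every parabolic cylinder Q(0,r)) at the space-time
origin. Weaker than TypeIAncientLiouville (stmt-NavierStokesRegularity-4050) and than (L)
(stmt-0057), still kills Type-I blow-up via SingularZoom. Follows from ClockCeiling ∧ ClockLaw by
two lines of logic (Sketch.lean `target_of_cruxes`). [rev 2, cone repair: the KNSS-mild Oseen clause
is unchanged in meaning — `oseenKernel (t−τ) (x−y) (u τ y) (u τ y)` is written out through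
`Literature.Analysis.UnboundedOperators.heatKernel` (bodies of
oseenKernel/oseenWeightA/oseenWeightB, KochTataruAdvMath2001 §2 (5)–(8)); DEFINITIONALLY equal to
the rev-1 statement (`Iff.rfl`; refuters may re-stamp against stmt-NavierStokesRegularity-10215 by
`Iff.rfl` / `simp only [Literature.Analysis.FluidPDE.oseenKernel,
Literature.Analysis.FluidPDE.oseenWeightA, Literature.Analysis.FluidPDE.oseenWeightB]`), so every
rev-1 audit note and evidence applies verbatim.] -/
@[route_item "route-NavierStokesRegularity-ClockStretchingLaw", crux]
def NoSingularTypeIModel : Prop :=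
  ∀ (C : ℝ) (u : ℝ → EuclideanSpace ℝ (Fin 3) → EuclideanSpace ℝ (Fin 3)), ContDiffOn ℝ (⊤ : ℕ∞) (Function.uncurry u) (Set.Iio 0 ×ˢ Set.univ) ∧ (∀ t < 0, Literature.Analysis.FluidPDE.VectorCalculus.IsDivFree (u t)) ∧ (∀ s t : ℝ, s < t → t < 0 → ∀ x, u t x = Literature.Analysis.FluidPDE.heatFlow (u s) (t - s) x - ∫ τ in Set.Ioo s t, ∫ y, ((-(inner ℝ (x - y) (u τ y) / (2 * (t - τ)) * Literature.Analysis.UnboundedOperators.heatKernel (t - τ) (x - y))) • u τ y + (∫ σ in Set.Ioi (t - τ), Literature.Analysis.UnboundedOperators.heatKernel σ (x - y) / (4 * σ ^ 2)) • (inner ℝ (x - y) (u τ y) • u τ y + inner ℝ (u τ y) (u τ y) • (x - y) + inner ℝ (x - y) (u τ y) • u τ y) - ((∫ σ in Set.Ioi (t - τ), Literature.Analysis.UnboundedOperators.heatKernel σ (x - y) / (8 * σ ^ 3)) * (inner ℝ (x - y) (u τ y) * inner ℝ (x - y) (u τ y))) • (x - y))) ∧ Literature.Analysis.FluidPDE.HasTypeITimeDecay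 C u ∧ (∀ (x₀ : EuclideanSpace ℝ (Fin 3)) (t₀ r : ℝ), t₀ ≤ 0 → 0 < r → (∀ t, t₀ - r ^ 2 < t → t < t₀ → r⁻¹ * ∫ x in Metric.ball x₀ r, ‖u t x‖ ^ 2 ≤ C) ∧ r⁻¹ * ∫ t in Set.Ioo (t₀ - r ^ 2) t₀, ∫ x in Metric.ball x₀ r, ‖fderiv ℝ (u t) x‖ ^ 2 ≤ C) → ¬ (∀ r > 0, ∀ M : ℝ, ∃ t ∈ Set.Ioo (-(r ^ 2)) (0 : ℝ), ∃ x ∈ Metric.ball (0 : EuclideanSpace ℝ (Fin 3)) r, M < ‖u t x‖)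

-- earlier ClockCeiling (stmt-NavierStokesRegularity-10216, replaced 2026-08-15T16:18:41Z -> stmt-NavierStokesRegularity-10570): retired by None — ∀ (C : ℝ) (u : ℝ → EuclideanSpace ℝ (Fin 3) → EuclideanSpace ℝ (Fin 3)), ContDiffOn ℝ (⊤ : ℕ∞) (Function.uncurry u) (Set.Iio 0 ×ˢ Set.univ) ∧ (∀ t < 0, Literature.Analysis.FluidPDE.VectorCalculus.IsDivFree (u t)) ∧ (∀ s t : ℝ, s < t → t < 0 → ∀ x, u t x = 
/-- item stmt-NavierStokesRegularity-10570 · crux · rank 2 · open · by planner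
why it might fail: False iff a singular Type-I model has inf a_u>0: a nontrivial backward λ-DSS/RDSS Type-I profile has log-periodic a_u>0 (SS/RSS: constant>0); excluded only for SS (NecasRuzickaSverak1996, Tsai1998) and λ≈1, |α|≪1 or ≫1 (ChaeWolf2017 Thm1.3, PineauVicol2026 Thms1.4/1.7); BradshawTsai2017 OP5.1 open.
sources: BradshawTsai2017CPDE, ChaeWolf2017RemovingDSS, PineauVicol2026, Tsai2018, NecasRuzickaSverak1996, Tsai1998
[crux] (card K1/K2, the bet) Along every element u of the Type-I class of the target, the clock
amplitude a_u(t) = (−t)^{3/2}∫|∂_t u(x,t)|² e^{−|x|²/(4(−t))}dx (= ‖W(s)‖²_{L²_ρ}, W = (−t)^{3/2}∂_t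
u in similarity variables = ΔU − U·∇U − ∇P, the steady-NS residual of the Leray profile) is NOT
bounded below on [−1,0): for every δ > 0 some t ∈ [−1,0) has a_u(t) < δ. At an origin where u is
bounded this is automatic (a_u(t) = O((−t)³) + Gaussian tail, the far-field pressure gradient being
bounded by the scaled energy A); the content is at singular origins. Intended engine: the exact
Leray-gauge identity d/ds ½a = −‖∇W‖²_ρ − (3/2)a + N_U(W) (N_U = strain compression + Gaussian
inflow + pressure work of the clock mode; OU min-max ⟨−𝓛φ,φ⟩_ρ ≥ ½‖φ‖²), so inf a > 0 forces ⟨N_U(Ŵ)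
− ‖∇Ŵ‖²_ρ⟩_s = 3/2 exactly; the crux bets no Type-I model sustains a normalised clock stretching of
3/2 (perturbative rung: SmallStrainRung). [difficulty: open-problem] [rev 2, cone repair: the
KNSS-mild Oseen clause is unchanged in meaning — `oseenKernel (t−τ) (x−y) (u τ y) (u τ y)` is
written out through `Literature.Analysis.UnboundedOperators.heatKernel` (bodies of
oseenKernel/oseenWeightA/oseenWeightB, KochTata -/
@[route_item "route-NavierStokesRegularity-ClockStretchingLaw", crux]
def ClockCeiling : Prop :=
  ∀ (C : ℝ) (u : ℝ → EuclideanSpace ℝ (Fin 3) → EuclideanSpace ℝ (Fin 3)), ContDiffOn ℝ (⊤ : ℕ∞) (Function.uncurry u) (Set.Iio 0 ×ˢ Set.univ) ∧ (∀ t < 0, Literature.Analysis.FluidPDE.VectorCalculus.IsDivFree (u t)) ∧ (∀ s t : ℝ, s < t → t < 0 → ∀ x, u t x = Literature.Analysis.FluidPDE.heatFlow (u s) (t - s) x - ∫ τ in Set.Ioo s t, ∫ y, ((-(inner ℝ (x - y) (u τ y) / (2 * (t - τ)) * Literature.Analysis.UnboundedOperators.heatKernel (t - τ) (x - y))) • u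 τ y + (∫ σ in Set.Ioi (t - τ), Literature.Analysis.UnboundedOperators.heatKernel σ (x - y) / (4 * σ ^ 2)) • (inner ℝ (x - y) (u τ y) • u τ y + inner ℝ (u τ y) (u τ y) • (x - y) + inner ℝ (x - y) (u τ y) • u τ y) - ((∫ σ in Set.Ioi (t - τ), Literature.Analysis.UnboundedOperators.heatKernel σ (x - y) / (8 * σ ^ 3)) * (inner ℝ (x - y) (u τ y) * inner ℝ (x - y) (u τ y))) • (x - y))) ∧ Literature.Analysis.FluidPDE.HasTypeITimeDecay C u ∧ (∀ (x₀ : EuclideanSpace ℝ (Fin 3)) (t₀ r : ℝ), t₀ ≤ 0 → 0 < r → (∀ t, t₀ - r ^ 2 < t → t < t₀ → r⁻¹ * ∫ x in Metric.ball x₀ r, ‖u t x‖ ^ 2 ≤ C) ∧ r⁻¹ * ∫ t in Set.Ioo (t₀ - r ^ 2) t₀, ∫ x in Metric.ball x₀ r, ‖fderiv ℝ (u t) x‖ ^ 2 ≤ C) → ∀ δ > 0, ∃ t : ℝ, -1 ≤ t ∧ t < 0 ∧ (-t) ^ ((3 : ℝ) / 2) * ∫ x, ‖Literature.Analysis.FluidPDE.timeDeriv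 u t x‖ ^ 2 * Real.exp (-(‖x‖ ^ 2) / (4 * (-t))) < δ

-- earlier ClockLaw (stmt-NavierStokesRegularity-10217, replaced 2026-08-15T16:18:41Z -> stmt-NavierStokesRegularity-10571): retired by None — ∀ (C : ℝ) (u : ℝ → EuclideanSpace ℝ (Fin 3) → EuclideanSpace ℝ (Fin 3)), ContDiffOn ℝ (⊤ : ℕ∞) (Function.uncurry u) (Set.Iio 0 ×ˢ Set.univ) ∧ (∀ t < 0, Literature.Analysis.FluidPDE.VectorCalculus.IsDivFree (u t)) ∧ (∀ s t : ℝ, s < t → t < 0 → ∀ x, u t x = Lite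
/-- item stmt-NavierStokesRegularity-10571 · crux · rank 3 · closed · proved by Summit.NavierStokesRegularity.NavierStokesRegularity.Theorems.clockStretchingLaw_clockLaw_proof @ 2311afa2f3b7 (prover) · by planner
why it might fail: Fails as stated iff a singular element has zoom limits regular at 0 (so a_u(t_n)→0): persistence of singularities (RusinSverak2011; AB2019 Prop 2.3) is in print only with L^{3/2} pressure D bounded; the class types A,E, not D — to be rebuilt from A via p=R_iR_j(u_iu_j), unwritten (AB2019 Rem 3.2).
sources: AlbrittonBarker2019, arXiv:1811.00502, RusinSverak2011, KNSS2009, DongZhang2020, Literature.Analysis.FluidPDE.knss2009_smoothing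
[crux] (card K1 non-degeneracy, "the clock cannot stop") If an element u of the Type-I class of the
target is singular at the space-time origin, its clock amplitude is bounded below on [−1,0): ∃ δ >
0, a_u(t) ≥ δ for −1 ≤ t < 0. Proof plan: (i) on [−1,−ε] continuity + SteadySliceLiouville (a_u(t*)
= 0 means ∂_t u(t*) ≡ 0, hence u ≡ 0, not singular); (ii) along t_n ↑ 0 rescale u_n(x,t) = λ_n u(λ_n
x, λ_n² t), λ_n = √(−t_n): the class is scale-invariant, KNSS smoothing gives C^∞_loc(t<0)
compactness and L²_ρ-convergence of the clock mode (|∂_t u| ≤ C₂(−t)^{−3/2} + Gaussian tails), the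
limit ū lies in the class, is singular at the origin by persistence of singularities
(RusinSverak2011 Lemma 2.1-2.2 = AlbrittonBarker2019 Prop 2.3; scaled energies A, E uniformly
bounded, C by interpolation, pressure in the mild gauge) hence nontrivial, and a_{u}(t_n) →
a_{ū}(−1) > 0 by SteadySliceLiouville again. [deps: SteadySliceLiouville] [difficulty: L] [rev 2,
cone repair: the KNSS-mild Oseen clause is unchanged in meaning — `oseenKernel (t−τ) (x−y) (u τ y)
(u τ y)` is written out through `Literature.Analysis.UnboundedOperators.heatKernel` (bodies of
oseenKernel/oseenWeightA/oseenWeightB, KochTata -/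
@[route_item "route-NavierStokesRegularity-ClockStretchingLaw", crux]
def ClockLaw : Prop :=
  ∀ (C : ℝ) (u : ℝ → EuclideanSpace ℝ (Fin 3) → EuclideanSpace ℝ (Fin 3)), ContDiffOn ℝ (⊤ : ℕ∞) (Function.uncurry u) (Set.Iio 0 ×ˢ Set.univ) ∧ (∀ t < 0, Literature.Analysis.FluidPDE.VectorCalculus.IsDivFree (u t)) ∧ (∀ s t : ℝ, s < t → t < 0 → ∀ x, u t x = Literature.Analysis.FluidPDE.heatFlow (u s) (t - s) x - ∫ τ in Set.Ioo s t, ∫ y, ((-(inner ℝ (x - y) (u τ y) / (2 * (t - τ)) * Literature.Analysis.UnboundedOperators.heatKernel (t - τ) (x - y))) • u τ y + (∫ σ in Set.Ioi (t - τ), Literature.Analysis.UnboundedOperators.heatKernel σ (x - y) / (4 * σ ^ 2)) • (inner ℝ (x - y) (u τ y) • u τ y + inner ℝ (u τ y) (u τ y) • (x - y) + inner ℝ (x - y) (u τ y) • u τ y) - ((∫ σ in Set.Ioi (t - τ), Literature.Analysis.UnboundedOperators.heatKernel σ (x - y) / (8 * σ ^ 3)) * (inner ℝ (x - y) (u τ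 y) * inner ℝ (x - y) (u τ y))) • (x - y))) ∧ Literature.Analysis.FluidPDE.HasTypeITimeDecay C u ∧ (∀ (x₀ : EuclideanSpace ℝ (Fin 3)) (t₀ r : ℝ), t₀ ≤ 0 → 0 < r → (∀ t, t₀ - r ^ 2 < t → t < t₀ → r⁻¹ * ∫ x in Metric.ball x₀ r, ‖u t x‖ ^ 2 ≤ C) ∧ r⁻¹ * ∫ t in Set.Ioo (t₀ - r ^ 2) t₀, ∫ x in Metric.ball x₀ r, ‖fderiv ℝ (u t) x‖ ^ 2 ≤ C) → (∀ r > 0, ∀ M : ℝ, ∃ t ∈ Set.Ioo (-(r ^ 2)) (0 : ℝ), ∃ x ∈ Metric.ball (0 : EuclideanSpace ℝ (Fin 3)) r, M < ‖u t x‖) → ∃ δ > 0, ∀ t : ℝ, -1 ≤ t → t < 0 → δ ≤ (-t) ^ ((3 : ℝ) / 2) * ∫ x, ‖Literature.Analysis.FluidPDE.timeDeriv u t x‖ ^ 2 * Real.exp (-(‖x‖ ^ 2) / (4 * (-t)))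

/-- item stmt-NavierStokesRegularity-0056 · crux · rank 4 · open · by planner
why it might fail: No theorem bounds a blow-up rate from above. Tao's averaged-NS blow-up is Type II (arXiv:1402.0290 p.8 fn.), so abstract methods cannot prove it; KNSS2009 p.4: every axisymmetric singularity is Type II, so Hou's axisymmetric candidate (arXiv:2107.06509), if real, refutes it (= ¬Clay A).
sources: Tao2016AveragedNS, arXiv:1402.0290, KNSS2009, Hou2022PotentiallySingularNS, arXiv:2107.06509, Seregin2012
If a finite-energy classical solution from a rapidly decaying datum has maximal lifespan T<∞ (no
classical extension past T), then ‖u(t)‖_∞ ≤ C (T−t)^{-1/2} eventually as t↑T (Leray's rate is the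
matching lower bound, leray_blowup_rate_top). The hardest and most informative crux: a
counterexample is a Type II singularity, i.e. ¬(Clay A). Known: lower bound c√ν (T−t)^{-1/2} (Leray
1934 §20); L³ must blow up (ESS 2003, Seregin 2012); only triple-log quantitative gain (Tao 2021). -/
@[route_item "route-NavierStokesRegularity-ClockStretchingLaw", crux]
def NoTypeII : Prop :=
  ∀ (ν T : ℝ), 0 < ν → 0 < T → ∀ (u : ℝ → EuclideanSpace ℝ (Fin 3) → EuclideanSpace ℝ (Fin 3)) (p : ℝ → EuclideanSpace ℝ (Fin 3) → ℝ), Literature.Analysis.FluidPDE.IsMaximalSmoothSolution ν 0 u p T → Literature.Analysis.FluidPDE.IsLerayHopfOn T ν 0 (u 0) u → Literature.Analysis.FluidPDE.HasRapidSpatialDecay (u 0) → Literature.Analysis.FluidPDE.IsTypeIBlowup u T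

/-- item stmt-NavierStokesRegularity-0055 · support · rank 9 · closed · proved by Summit.NavierStokesRegularity.NavierStokesRegularity.Theorems.typeICertificateLadder_noBlowupToClay_proof @ f501e9774e4d (prover) · by planner
sources: Leray1934, FujitaKato1964, Fefferman2000
Given NoBlowup, build the Clay (A) solution: local finite-energy classical solution for smooth
divergence-free rapidly decaying data (Leray 1934 §III / Fujita–Kato 1964 + LPS smoothing), continue
past every T using NoBlowup, glue by weak–strong uniqueness (Prodi–Serrin), bounded energy from the
energy inequality, and convert with
Literature.Analysis.FluidPDE.isNavierStokesSolution_and_smooth_iff. Blow-up at spatial infinity is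
excluded by CKN ε-regularity applied far out. May take named Literature facts (leray_existence_R3,
ladyzhenskaya_prodi_serrin, weak_strong_uniqueness, fujita_kato_local) as hypotheses if the grounder
so rules. -/
@[route_item "route-NavierStokesRegularity-ClockStretchingLaw", crux]
def NoBlowupToClay : Prop :=
  (∀ (ν T : ℝ), 0 < ν → 0 < T → ∀ (u : ℝ → EuclideanSpace ℝ (Fin 3) → EuclideanSpace ℝ (Fin 3)) (p : ℝ → EuclideanSpace ℝ (Fin 3) → ℝ), Literature.Analysis.FluidPDE.IsClassicalNSSolutionOn (Set.Ico 0 T) ν 0 u p → Literature.Analysis.FluidPDE.IsLerayHopfOn T ν 0 (u 0) u → Literature.Analysis.FluidPDE.HasRapidSpatialDecay (u 0) → Literature.Analysis.FluidPDE.HasSmoothExtensionPast ν 0 u T) → NavierStokesRegularity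

/-- `NoBlowupToClay` holds: proved by `Summit.NavierStokesRegularity.NavierStokesRegularity.Theorems.typeICertificateLadder_noBlowupToClay_proof` @ f501e9774e4d. -/
theorem NoBlowupToClay_holds : NoBlowupToClay := _root_.Summit.NavierStokesRegularity.NavierStokesRegularity.Theorems.typeICertificateLadder_noBlowupToClay_proof

-- earlier SteadySliceLiouville (stmt-NavierStokesRegularity-10218, replaced 2026-08-15T16:18:41Z -> stmt-NavierStokesRegularity-10572): retired by None — ∀ (C : ℝ) (u : ℝ → EuclideanSpace ℝ (Fin 3) → EuclideanSpace ℝ (Fin 3)), ContDiffOn ℝ (⊤ : ℕ∞) (Function.uncurry u) (Set.Iio 0 ×ˢ Set.univ) ∧ (∀ t < 0, Literature.Analysis.FluidPDE.VectorCalculus.IsDivFree (u t)) ∧ (∀ s t : ℝ, s < t → t < 0 → ∀ x, 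
/-- item stmt-NavierStokesRegularity-10572 · support · rank 9 · closed · proved by Summit.NavierStokesRegularity.NavierStokesRegularity.Theorems.clockStretchingLaw_steadySliceLiouville_proof (prover) · by planner
sources: DongZhang2020, arXiv:1907.01687, KNSS2009, Seregin2014Notes
[support] (card degeneracy lemma, clock case; known ingredients) a smooth div-free KNSS-mild ancient
solution with |u| ≤ C/√(−t) and ONE steady slice ∂_t u(t₀,·) ≡ 0 (t₀ < 0) is identically zero: ∂_t^n
u(t₀,·) ≡ 0 inductively (∂_t p = R_iR_j∂_t(u_iu_j) in the mild gauge), time analyticity of bounded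
mild solutions (DongZhang2020 Thm 2 = arXiv:1907.01687, radius depending only on the L^∞ bound)
propagates u(t) = u(t₀) to all t < 0, and |u(t₀,x)| = |u(t,x)| ≤ C/√(−t) → 0 as t → −∞. (Forward
uniqueness alone is useless: the Type-I bound is void as t ↑ 0.) May take a named DongZhang2020 fact
as hypothesis if the grounder so rules. [difficulty: L] [rev 2, cone repair: the KNSS-mild Oseen
clause is unchanged in meaning — `oseenKernel (t−τ) (x−y) (u τ y) (u τ y)` is written out through
`Literature.Analysis.UnboundedOperators.heatKernel` (bodies of
oseenKernel/oseenWeightA/oseenWeightB, KochTataruAdvMath2001 §2 (5)–(8)); DEFINITIONALLY equal to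
the rev-1 statement (`Iff.rfl`; refuters may re-stamp against stmt-NavierStokesRegularity-10218 by
`Iff.rfl` / `simp only [Literature.Analysis.FluidPDE.oseenKernel,
Literature.Analysis.FluidPDE.oseenWeightA, Literature.Analysis.FluidPDE.oseenWeightB -/
@[route_item "route-NavierStokesRegularity-ClockStretchingLaw"]
def SteadySliceLiouville : Prop :=
  ∀ (C : ℝ) (u : ℝ → EuclideanSpace ℝ (Fin 3) → EuclideanSpace ℝ (Fin 3)), ContDiffOn ℝ (⊤ : ℕ∞) (Function.uncurry u) (Set.Iio 0 ×ˢ Set.univ) ∧ (∀ t < 0, Literature.Analysis.FluidPDE.VectorCalculus.IsDivFree (u t)) ∧ (∀ s t : ℝ, s < t → t < 0 → ∀ x, u t x = Literature.Analysis.FluidPDE.heatFlow (u s) (t - s) x - ∫ τ in Set.Ioo s t, ∫ y, ((-(inner ℝ (x - y) (u τ y) / (2 * (t - τ)) * Literature.Analysis.UnboundedOperators.heatKernel (t - τ) (x - y))) • u τ y + (∫ σ in Set.Ioi (t - τ), Literature.Analysis.UnboundedOperators.heatKernel σ (x - y) / (4 * σ ^ 2)) • (inner ℝ (x - y) (u τ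 y) • u τ y + inner ℝ (u τ y) (u τ y) • (x - y) + inner ℝ (x - y) (u τ y) • u τ y) - ((∫ σ in Set.Ioi (t - τ), Literature.Analysis.UnboundedOperators.heatKernel σ (x - y) / (8 * σ ^ 3)) * (inner ℝ (x - y) (u τ y) * inner ℝ (x - y) (u τ y))) • (x - y))) ∧ Literature.Analysis.FluidPDE.HasTypeITimeDecay C u → ∀ t₀ < 0, (∀ x, Literature.Analysis.FluidPDE.timeDeriv u t₀ x = 0) → ∀ t < 0, ∀ x, u t x = 0

-- earlier SingularZoom (stmt-NavierStokesRegularity-10219, replaced 2026-08-15T16:18:41Z -> stmt-NavierStokesRegularity-10573): retired by None — (∀ (C : ℝ) (u : ℝ → EuclideanSpace ℝ (Fin 3) → EuclideanSpace ℝ (Fin 3)), ContDiffOn ℝ (⊤ : ℕ∞) (Function.uncurry u) (Set.Iio 0 ×ˢ Set.univ) ∧ (∀ t < 0, Literature.Analysis.FluidPDE.VectorCalculus.IsDivFree (u t)) ∧ (∀ s t : ℝ, s < t → t < 0 → ∀ x, u t x =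
/-- item stmt-NavierStokesRegularity-10573 · support · rank 9 · closed · proved by Summit.NavierStokesRegularity.NavierStokesRegularity.Theorems.singularZoom_proof (prover) · by planner
sources: AlbrittonBarker2019, RusinSverak2011, KNSS2009, SereginSverak2009, CKN1982
[support] (glue, KNOWN: AlbrittonBarker2019 §3 forward direction + KNSS2009 §6) X_sing ⇒ a
finite-energy classical solution on [0,T) from a rapidly decaying datum with Type-I rate near T
extends smoothly past T. If not, u is unbounded near T (continuation), the singular set at time T is
a nonempty compact set (far-field ε-regularity, CKN1982), pick a singular point (x₀,T); the zooms
u_k(x,t) = λ_k u(x₀+λ_k x, T+λ_k² t), λ_k ↓ 0 (NO sup-normalisation) keep the sup-rate constant,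
inherit scale-invariant energies from 𝐈(Q((x₀,T),ρ)) < ∞ (AlbrittonBarker2019 Lemma 2.5 'weak Serrin
⇒ Type I', u ∈ L^{2,∞}_t L^∞_x), converge in C^∞_loc(t<0) by KNSS2009 Prop 4.1 bounds to a KNSS-mild
limit ū (dominated convergence in the Oseen identity, kernel bound (14)) which is in the Type-I
class with constant max(C, C′) and singular at (0,0) by persistence of singularities
(RusinSverak2011; AlbrittonBarker2019 Prop 2.3) — contradicting X_sing. May take named facts
(knss2009_smoothing, hasSmoothExtensionPast_of_bounded, CKN ε-regularity) as hypotheses if the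
grounder so rules. [difficulty: L] [rev 2, cone repair: the KNSS-mild Oseen clause is unchanged in
meaning — `oseenKernel (t−τ) (x−y) (u τ y) (u τ -/
@[route_item "route-NavierStokesRegularity-ClockStretchingLaw", crux]
def SingularZoom : Prop :=
  (∀ (C : ℝ) (u : ℝ → EuclideanSpace ℝ (Fin 3) → EuclideanSpace ℝ (Fin 3)), ContDiffOn ℝ (⊤ : ℕ∞) (Function.uncurry u) (Set.Iio 0 ×ˢ Set.univ) ∧ (∀ t < 0, Literature.Analysis.FluidPDE.VectorCalculus.IsDivFree (u t)) ∧ (∀ s t : ℝ, s < t → t < 0 → ∀ x, u t x = Literature.Analysis.FluidPDE.heatFlow (u s) (t - s) x - ∫ τ in Set.Ioo s t, ∫ y, ((-(inner ℝ (x - y) (u τ y) / (2 * (t - τ)) * Literature.Analysis.UnboundedOperators.heatKernel (t - τ) (x - y))) • u τ y + (∫ σ in Set.Ioi (t - τ), Literature.Analysis.UnboundedOperators.heatKernel σ (x - y) / (4 * σ ^ 2)) • (inner ℝ (x - y) (u τ y) • u τ y + inner ℝ (u τ y) (u τ y) • (x - y) + inner ℝ (x - y) (u τ y) • u τ y) -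 ((∫ σ in Set.Ioi (t - τ), Literature.Analysis.UnboundedOperators.heatKernel σ (x - y) / (8 * σ ^ 3)) * (inner ℝ (x - y) (u τ y) * inner ℝ (x - y) (u τ y))) • (x - y))) ∧ Literature.Analysis.FluidPDE.HasTypeITimeDecay C u ∧ (∀ (x₀ : EuclideanSpace ℝ (Fin 3)) (t₀ r : ℝ), t₀ ≤ 0 → 0 < r → (∀ t, t₀ - r ^ 2 < t → t < t₀ → r⁻¹ * ∫ x in Metric.ball x₀ r, ‖u t x‖ ^ 2 ≤ C) ∧ r⁻¹ * ∫ t in Set.Ioo (t₀ - r ^ 2) t₀, ∫ x in Metric.ball x₀ r, ‖fderiv ℝ (u t) x‖ ^ 2 ≤ C) → ¬ (∀ r > 0, ∀ M : ℝ, ∃ t ∈ Set.Ioo (-(r ^ 2)) (0 : ℝ), ∃ x ∈ Metric.ball (0 : EuclideanSpace ℝ (Fin 3)) r, M < ‖u t x‖)) → ∀ (ν T : ℝ), 0 < ν → 0 < T → ∀ (u : ℝ → EuclideanSpace ℝ (Fin 3) → EuclideanSpace ℝ (Fin 3)) (p : ℝ → EuclideanSpace ℝ (Fin 3) → ℝ),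 Literature.Analysis.FluidPDE.IsClassicalNSSolutionOn (Set.Ico 0 T) ν 0 u p → Literature.Analysis.FluidPDE.IsLerayHopfOn T ν 0 (u 0) u → Literature.Analysis.FluidPDE.HasRapidSpatialDecay (u 0) → Literature.Analysis.FluidPDE.IsTypeIBlowup u T → Literature.Analysis.FluidPDE.HasSmoothExtensionPast ν 0 u T

-- earlier SmallStrainRung (stmt-NavierStokesRegularity-10220, replaced 2026-08-15T16:18:41Z -> stmt-NavierStokesRegularity-10574): retired by None — ∀ (C : ℝ) (u : ℝ → EuclideanSpace ℝ (Fin 3) → EuclideanSpace ℝ (Fin 3)), ContDiffOn ℝ (⊤ : ℕ∞) (Function.uncurry u) (Set.Iio 0 ×ˢ Set.univ) ∧ (∀ t < 0, Literature.Analysis.FluidPDE.VectorCalculus.IsDivFree (u t)) ∧ (∀ s t : ℝ, s < t → t < 0 → ∀ x, u t x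
/-- item stmt-NavierStokesRegularity-10574 · support · rank 9 · closed · proved by Summit.NavierStokesRegularity.NavierStokesRegularity.Theorems.clockStretchingLaw_smallStrainRung_proof @ f648441f8c8f (prover) · by planner
sources: KNSS2009, CortissozMonteroPinilla2014, Leray1934
[support] (card K2, perturbative rung of ClockCeiling; TRUE by the vorticity maximum principle,
filed to calibrate the ceiling) a smooth div-free KNSS-mild ancient solution with |u| ≤ C/√(−t) and
(−t)‖∇u(t)‖_{op,∞} ≤ ½ for all t < 0 vanishes: |Sω| ≤ ‖∇u‖_op|ω| gives ‖ω(t)‖_∞ ≤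
‖ω(s)‖_∞((−s)/(−t))^{1/2} ≤ c(−s)^{−1/2}(−t)^{−1/2} → 0 as s → −∞ (any constant < 1 works), so ω ≡
0, u(t,·) is harmonic and bounded hence spatially constant, the Oseen identity (zero-mean kernel)
makes it constant in time, and Type-I decay makes it 0. The card predicts the threshold can be
pushed to the min-max constant of the clock law (layer 2). [difficulty: M] [rev 2, cone repair: the
KNSS-mild Oseen clause is unchanged in meaning — `oseenKernel (t−τ) (x−y) (u τ y) (u τ y)` is
written out through `Literature.Analysis.UnboundedOperators.heatKernel` (bodies of
oseenKernel/oseenWeightA/oseenWeightB, KochTataruAdvMath2001 §2 (5)–(8)); DEFINITIONALLY equal to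
the rev-1 statement (`Iff.rfl`; refuters may re-stamp against stmt-NavierStokesRegularity-10220 by
`Iff.rfl` / `simp only [Literature.Analysis.FluidPDE.oseenKernel,
Literature.Analysis.FluidPDE.oseenWeightA, Literature.Analysis.FluidPDE.oseenWeightB]`), s -/
@[route_item "route-NavierStokesRegularity-ClockStretchingLaw"]
def SmallStrainRung : Prop :=
  ∀ (C : ℝ) (u : ℝ → EuclideanSpace ℝ (Fin 3) → EuclideanSpace ℝ (Fin 3)), ContDiffOn ℝ (⊤ : ℕ∞) (Function.uncurry u) (Set.Iio 0 ×ˢ Set.univ) ∧ (∀ t < 0, Literature.Analysis.FluidPDE.VectorCalculus.IsDivFree (u t)) ∧ (∀ s t : ℝ, s < t → t < 0 → ∀ x, u t x = Literature.Analysis.FluidPDE.heatFlow (u s) (t - s) x - ∫ τ in Set.Ioo s t, ∫ y, ((-(inner ℝ (x - y) (u τ y) / (2 * (t - τ)) * Literature.Analysis.UnboundedOperators.heatKernel (t - τ) (x - y))) • u τ y + (∫ σ in Set.Ioi (t - τ), Literature.Analysis.UnboundedOperators.heatKernel σ (x - y) / (4 * σ ^ 2)) • (inner ℝ (x - y) (u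 τ y) • u τ y + inner ℝ (u τ y) (u τ y) • (x - y) + inner ℝ (x - y) (u τ y) • u τ y) - ((∫ σ in Set.Ioi (t - τ), Literature.Analysis.UnboundedOperators.heatKernel σ (x - y) / (8 * σ ^ 3)) * (inner ℝ (x - y) (u τ y) * inner ℝ (x - y) (u τ y))) • (x - y))) ∧ Literature.Analysis.FluidPDE.HasTypeITimeDecay C u → (∀ t < 0, ∀ x, ‖fderiv ℝ (u t) x‖ ≤ (1 / 2) / (-t)) → ∀ t < 0, ∀ x, u t x = 0

/-- item stmt-NavierStokesRegularity-10221 · assembly · rank 1 · closed · proved by Summit.NavierStokesRegularity.NavierStokesRegularity.Theorems.clockStretchingLaw_assembly_proof (prover) · by planner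
sources: Fefferman2000, KNSS2009, AlbrittonBarker2019
[assembly] ClockCeiling → ClockLaw → SingularZoom → NoTypeII → NoBlowupToClay →
NavierStokesRegularity. -/
@[route_item "route-NavierStokesRegularity-ClockStretchingLaw"]
def Assembly : Prop :=
  ClockCeiling → ClockLaw → SingularZoom → NoTypeII → NoBlowupToClay → NavierStokesRegularity

/-! D-0027 §2.1 — DECIDING THEOREM (planner-authored via `route open/edit --closes-file`; by planner-rrepair-NavierStokesRegularity-ClockSt-753af43a-g2-0 2026-08-15T16:18:41Z):
its hypotheses are this route's items and its conclusion the sub-problem Statement (glue_lint), and it elaborates with this file. -/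

@[closes "route-NavierStokesRegularity-ClockStretchingLaw"] theorem closes (hA : ClockCeiling) (hB : ClockLaw) (hZ : SingularZoom) (hII : NoTypeII) (hClay : NoBlowupToClay) : NavierStokesRegularity := by
  apply hClay
  intro ν T hν hT u p hcl hLH hdec
  by_contra hext
  have hTI : Literature.Analysis.FluidPDE.IsTypeIBlowup u T :=
    hII ν T hν hT u p ⟨hcl, hext⟩ hLH hdec
  refine hext (hZ ?_ ν T hν hT u p hcl hLH hdec hTI)
  intro C v hv hsing
  obtain ⟨δ, hδ, hlow⟩ := hB C v hv hsing
  obtain ⟨t, ht1, ht2, hlt⟩ := hA C v hv δ hδ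
  exact absurd (hlow t ht1 ht2) (not_le.mpr hlt)

end Summit.NavierStokesRegularity.NavierStokesRegularity.Theses.ClockStretchingLaw
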